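import Summits.HodgeConjecture.HodgeConjecture.Theses.PadicSemiregularLift
import Summits.HodgeConjecture.HodgeConjecture.Theses.TropicalCuspLift
import Summits.HodgeConjecture.HodgeConjecture.Theorems.PadicSemiregularLiftHodgeAbelianVarietiesStubSplitSixfolds
import Literature.AlgebraicGeometry.Motives.Jacobian
import Literature.AlgebraicGeometry.Motives.PrymVariety
import Literature.AlgebraicGeometry.HodgeTheory.WeilClasses
import Literature.AlgebraicGeometry.HodgeTheory.BlochSemiregularityMapReal
import Literature.AlgebraicGeometry.HodgeTheory.GlobalInvariantCycles
import Literature.AlgebraicGeometry.Motives.FamiliesVHS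
import Literature.AlgebraicGeometry.Motives.HyperbolicWeilType

/-!
# Crux `HodgeAbelianVarieties` (stmt-HodgeConjecture-1333), line `prym-canonical-z3-split-seeds`: shared VOCABULARY of the
# registered stubs (definitions file, `--supports`; nothing here restates the crux or asserts anything)

Route `PadicSemiregularLift`, crux r4 `HodgeAbelianVarieties := ∀ A : AbelianVariety ℂ, HodgeConjectureFor A.dim A.X`.
The line's skeleton (`Cruxes/HodgeAbelianVarieties/Lines/prym_canonical_z3_split_seeds.lean`, lead gen 2, 2026-08-16)
states its six stubs over the predicates below, on REAL carriers; the stub-workers' helper files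
(`Theorems/PadicSemiregularLiftHodgeAbelianVarietiesStub*.lean`) must all speak the SAME predicates, so they are
landed once, here, byte-identical to the skeleton (same namespace `…Cruxes.HodgeAbelianVarieties.PrymCanonicalZ3SplitSeeds`,
same names), exactly as `Theorems/PadicSemiregularLiftHodgeAbelianVarietiesEStepDefs.lean` did for the e-step line:
`schoenPrym`, `IsSchoenPrymPair` (+ the sanity lemma `comp_self_of_isSchoenPrymPair`, PROVED: `ψ₀ ≫ ψ₀ = -3`), `symHyp`,
`pow4`, `PrymSpread` (stub 3's hypothesis: what stubs 1 + 2 deliver). `SemiregularSchoenSeed` (stub 1's statement, with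
the gen-2 lci conjunct `Literature.AlgebraicGeometry.HodgeTheory.IsRegularImmersionOfCodim i 4` from
`Literature/AlgebraicGeometry/HodgeTheory/BlochSemiregularSpread`, landed 2026-08-16) is APPENDED to this file once that
Literature module is built on the farm (append-only protocol). Stub 2's statement is the tree's named fact
`Literature.AlgebraicGeometry.HodgeTheory.BlochSemiregularSpread` itself and is not redeclared; the four EDGE statements of
stubs 3–6 (`SpreadClosing := PrymSpread → Stubs.WeilAlgebraicSplitHyperplane 4 3`, `Descend`, `WeilSectorOffReach`,
`WeilSectorSuffices`) are parameter-free implications between typed statements of the tree (HC-implied; the last two open)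
and stay in the skeleton, deliberately NOT declared here, so that nothing in this file can be mistaken for a named fact
(same policy as the e-step Defs file). `PrymSpread` (and later `SemiregularSchoenSeed`) are the line's OWN open statements (the
bet's first consequence, resp. the bet), recorded as definitions so that helper files prove implications between them;
neither is asserted, cited as a fact, or a restatement of the crux. Sources for the notions: Schoen, Compositio 65 (1988) Thm 2.0 / §3 (cyclic-triple Pryms, split Prym-canonical
cycles); van Geemen LNM 1594 §5, §7 (Weil type, hyperbolic = split); Bloch 1972 / Buchweitz–Flenner 2003 Thm 5.2
(semiregularity); Markman arXiv:2509.23403 §11.5 (descending).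
-/

set_option linter.dupNamespace false

noncomputable section

open CategoryTheory AlgebraicGeometry
open Literature.AlgebraicGeometry Literature.AlgebraicGeometry.Motives
  Literature.AlgebraicGeometry.HodgeTheory Literature.Geometry.Kaehler

namespace Summit.HodgeConjecture.HodgeConjecture.Cruxes.HodgeAbelianVarieties.PrymCanonicalZ3SplitSeeds

open Summit.HodgeConjecture.HodgeConjecture.Cruxes.HodgeAbelianVarieties.EStepSecantInduction

/-! ### Vocabulary (real carriers only) -/

/-- **Schoen's cyclic-triple Prym inside `J(C)`**: the identity component `(ker (𝟙 + s + s²))⁰_red` of the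
kernel of `Φ₃(s)`, `s = α_*` (`Jacobian.pushforward`), as an abelian variety (`AbelianVariety.kerComponent`,
`Motives/PrymVariety`). For an étale `ℤ/3`-cover `C → C/⟨α⟩` this IS the Prym `(ker Nm)⁰`:
`π^* ∘ Nm = 𝟙 + s + s²` and `π^*` has finite kernel (Schoen 1988 §3 p. 24; the tree's `ℤ/6` sibling
`Schoen1988_cyclicPrym_weilClasses_algebraic_degreeSix` uses `Φ₆(s)` the same way). -/
abbrev schoenPrym {C : SchemeOver ℂ} (𝒥 : Jacobian C) (α : C ⟶ C) : AbelianVariety ℂ :=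
  AbelianVariety.kerComponent
    (𝟙 𝒥.J + 𝒥.pushforward 𝒥 α + 𝒥.pushforward 𝒥 α ≫ 𝒥.pushforward 𝒥 α)

/-- **`(P, ψ₀)` is a genus-5 Schoen–Prym pair**: `P` is isomorphic, as an abelian variety, to the Prym
`(ker(𝟙 + α_* + α_*²))⁰ ⊂ J(C)` of a smooth projective complex curve `C` with Jacobian of dimension `13`
(= `g(C)`) carrying a fixed-point-free automorphism `α` of order `3` (so `C → C/⟨α⟩` is étale cyclic of
degree `3` onto a curve of genus `5`: `24 = 2·13 - 2 = 3·(2·5 - 2)`), the isomorphism intertwining `ψ₀`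
with `𝟙 + 2 α_P` (`α_P` the restriction of `α_*`, which exists: `AbelianVariety.kerComponentRestrict`;
`𝟙 + 2ζ₃^{±1} = ±i√3`, so `ψ₀² = -3`: `comp_self_of_isSchoenPrymPair`), and `dim P = 8` (the dimension formula
`13 = 5 + 8`, recorded as a conjunct). -/
def IsSchoenPrymPair (P : AbelianVariety ℂ) (ψ₀ : P ⟶ P) : Prop :=
  ∃ (C : SchemeOver ℂ) (𝒥 : Jacobian C) (α : C ⟶ C) (sP : schoenPrym 𝒥 α ⟶ schoenPrym 𝒥 α)
    (g : P ≅ schoenPrym 𝒥 α),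
    IsSmoothProjective 1 C ∧ 𝒥.J.dim = 13 ∧ α ≫ α ≫ α = 𝟙 C ∧
    (∀ x : ComplexPoints C, x ≫ α ≠ x) ∧
    sP ≫ AbelianVariety.kerComponentι _ =
      AbelianVariety.kerComponentι _ ≫ 𝒥.pushforward 𝒥 α ∧
    g.hom ≫ (𝟙 _ + 2 • sP) = ψ₀ ≫ g.hom ∧
    P.dim = 2 * 4

/-- Sanity (PROVED): on a Schoen–Prym pair `ψ₀ ≫ ψ₀ = -3`, i.e. `ℤ[ψ₀] = ℤ[√-3]` acts (`Φ₃(α_P) = 0` on the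
identity component of `ker Φ₃(α_*)`, hence `(𝟙 + 2α_P)² = 1 + 4α_P + 4α_P² = -3`). In particular the
trivial family over `Spec ℂ` is an instance of the inner `∀`-clause of `PrymSpread` (vacuity audit). -/
theorem comp_self_of_isSchoenPrymPair :
    ∀ {P : AbelianVariety ℂ} {ψ₀ : P ⟶ P}, IsSchoenPrymPair P ψ₀ → ψ₀ ≫ ψ₀ = -(3 • 𝟙 P) := by
  intro P ψ₀ h
  obtain ⟨C, 𝒥, α, sP, g, -, -, -, -, hsP, hg, -⟩ := h
  have hι := AbelianVariety.kerComponentι_comp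
    (𝟙 𝒥.J + 𝒥.pushforward 𝒥 α + 𝒥.pushforward 𝒥 α ≫ 𝒥.pushforward 𝒥 α)
  have hΦ : 𝟙 _ + sP + sP ≫ sP = 0 := by
    rw [← cancel_mono (AbelianVariety.kerComponentι
      (𝟙 𝒥.J + 𝒥.pushforward 𝒥 α + 𝒥.pushforward 𝒥 α ≫ 𝒥.pushforward 𝒥 α)), Limits.zero_comp,
      ← hι, Preadditive.add_comp, Preadditive.add_comp, Category.id_comp, Category.assoc, hsP,
      ← Category.assoc, hsP, Category.assoc, Preadditive.comp_add, Preadditive.comp_add,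
      Category.comp_id]
  have h2 : sP ≫ sP = -𝟙 _ - sP := by
    rw [eq_sub_iff_add_eq, eq_neg_iff_add_eq_zero, ← hΦ]; abel
  have hψ : (𝟙 _ + 2 • sP) ≫ (𝟙 _ + 2 • sP) = -(3 • 𝟙 (schoenPrym 𝒥 α)) := by
    simp only [Preadditive.add_comp, Preadditive.comp_add, Category.id_comp, Category.comp_id,
      Preadditive.nsmul_comp, Preadditive.comp_nsmul, h2]
    abel
  have : ψ₀ = g.hom ≫ (𝟙 _ + 2 • sP) ≫ g.inv := by
    rw [← Category.assoc, hg, Category.assoc, g.hom_inv_id, Category.comp_id]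
  rw [this, Category.assoc, Category.assoc, g.inv_hom_id_assoc, ← Category.assoc (𝟙 _ + 2 • sP),
    hψ]
  simp

/-- The **`K`-symmetrised hyperplane class** `h_K := 3·e^*a + φ^*(e^*a)` of a projective embedding `e` and
a class `a ∈ H²(ℙᴺ(ℂ); ℂ)` (the tree's ampleness proxy for a `φ`-compatible polarization, `d = 3`:
`Stubs.WeilAlgebraicSplitHyperplane`, `HeckePrymWeil.HyperbolicEightfoldsSqrtMinus7`; automatically
`φ`-compatible: `φ^* h_K = 3 h_K` when `φ ≫ φ = -3`). -/
abbrev symHyp {A : AbelianVariety ℂ} (φ : A ⟶ A) (e : ProjectiveEmbedding A.X)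
    (a : complexBetti (projectiveSpace e.n ℂ) 2) : complexBetti A.X 2 :=
  (3 : ℂ) • complexBetti.map e.ι 2 a + complexBetti.map φ.hom.hom.hom 2 (complexBetti.map e.ι 2 a)

/-- `h⁴ = h ⌣ h ⌣ h ⌣ h ∈ H⁸` (third Lefschetz iterate of `h` applied to `h`). -/
abbrev pow4 {X : SchemeOver ℂ} (h : complexBetti X 2) : complexBetti X (2 * 4) :=
  lefschetzPow h 3 2 h

local notation3 (prettyPrint := false) "Res[" f ", " s ", " k ", " A "]" =>
  complexBetti.map (Motives.fiberι f s) k A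

/-- **`PrymSpread`** — the hypothesis of STUB 3 (what STUBS 1 + 2 deliver, `prymSpread_of_seed_of_bloch`):
at SOME genus-5 Schoen–Prym pair `(P, ψ₀)`, hyperbolic for `h_K = 3e^*a + ψ₀^*e^*a`, some rational class
`x = w + c·h_K⁴` with NON-ZERO Weil component `w` SPREADS: for EVERY smooth projective family
`f : 𝒳 ⟶ S` of abelian eightfolds with `√-3`-multiplication over a smooth irreducible quasi-projective base,
anchored at `P` (`e' : P ≅ 𝒳_{s₀}`) and carrying global classes `W` (fibrewise rational `(4,4)`,
`e'^*(W|_{s₀}) = x`) and `H` (fibrewise rational `(1,1)`, `e'^*(H|_{s₀}) = h_K`), the class `W|_t` is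
algebraic on a NON-EMPTY OPEN subset of `S(ℂ)`. Never vacuous: the constant family over `Spec ℂ` is an
instance (so `x` itself must be algebraic on `P`), and so is the universal family over the split
`ℚ(√-3)` `(4,4)` Shimura component through `(P, K, h_K)` (global `W`, `H` by Deligne's fixed part after a
finite étale base change killing `det` of the monodromy — this is where `IsRationalClass x` and
hyperbolicity are used). -/
def PrymSpread : Prop :=
  ∃ (P : AbelianVariety ℂ) (ψ₀ : P ⟶ P) (e : ProjectiveEmbedding P.X)
    (a : complexBetti (projectiveSpace e.n ℂ) 2) (w : complexBetti P.X (2 * 4)) (c : ℂ),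
    IsSchoenPrymPair P ψ₀ ∧ IsRationalClass a ∧ a ≠ 0 ∧
    IsHyperbolicWeilType P ψ₀ 4 (symHyp ψ₀ e a) ∧
    w ∈ weilClassesOf P ψ₀ 4 3 ∧ w ≠ 0 ∧
    IsRationalClass (w + c • pow4 (symHyp ψ₀ e a)) ∧
    ∀ (𝒳 S : SchemeOver ℂ) (f : 𝒳 ⟶ S) (s₀ : ComplexPoints S) (e' : P.X ≅ fiberOver f s₀)
      (W : complexBetti 𝒳 (2 * 4)) (H : complexBetti 𝒳 2),
      IsSmoothProjectiveFamily f (2 * 4) → IsQuasiProjectiveOver 𝒳 → IsQuasiProjectiveOver S →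
      Smooth S.hom → IrreducibleSpace S.left →
      (∀ s : ComplexPoints S, ∃ (A' : AbelianVariety ℂ) (φ' : A' ⟶ A'),
        A'.dim = 2 * 4 ∧ φ' ≫ φ' = -(3 • 𝟙 A') ∧ Nonempty (A'.X ≅ fiberOver f s)) →
      (∀ s : ComplexPoints S, IsRationalClass (Res[f, s, 2 * 4, W]) ∧
        IsOfHodgeType (2 * 4) (fiberOver f s) (2 * 4) 4 4 (Res[f, s, 2 * 4, W])) →
      (∀ s : ComplexPoints S, IsRationalClass (Res[f, s, 2, H]) ∧
        IsOfHodgeType (2 * 4) (fiberOver f s) 2 1 1 (Res[f, s, 2, H])) →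
      complexBetti.map e'.hom (2 * 4) (Res[f, s₀, 2 * 4, W]) = w + c • pow4 (symHyp ψ₀ e a) →
      complexBetti.map e'.hom 2 (Res[f, s₀, 2, H]) = symHyp ψ₀ e a →
      ∃ U : Set (ComplexPoints S), IsOpen U ∧ U.Nonempty ∧
        ∀ t ∈ U, Res[f, t, 2 * 4, W] ∈ algebraicClasses (fiberOver f t) 4

end Summit.HodgeConjecture.HodgeConjecture.Cruxes.HodgeAbelianVarieties.PrymCanonicalZ3SplitSeeds

end
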